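import Literature.AnabelianGeometry.AbsoluteAnabelian.AbsTopII.EllipticCuspidalizationTFContent
import Literature.AnabelianGeometry.AbsoluteAnabelian.AbsTopII.EllipticCuspidalizationCanonicalPinScope
import HarnessLib

/-!
# [AbsTopII] Cor 3.3 (iii)(a): a PRINT-FAITHFUL record REALIZING the printed chain has a NON-injective
# cuspidalization for `N ≥ 2` (non-degeneracy of `EllipticCuspidalizationTF.RealizesChain`; finding T1g11-F1)

S. Mochizuki, *Topics in Absolute Anabelian Geometry II* [AbsTopII] (bib `MochizukiAbsTopII2013`), §3,
Ex 3.2 (i)(ii) pp. 66–67 (the chain `X ⇝ V ⇝ D ⇝ U ⇝ U_{N²−1} ⇝ ⋯ ⇝ U_1 = D`, "`N² − 1` de-cuspidalization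
operations"), Cor 3.3 (iii)(a) p. 68 ("such that the natural surjection `Π_U ↠ Π_D` may be recovered from the
chain of •'s terminating at the third to last group"); [AbsTopI] (`MochizukiAbsTopI2012`) Def 4.2 (iii)(c)
pp. 49–50 (type •: "a surjection `Πⱼ ↠ Πⱼ₊₁` such that `Ker` is topologically normally generated by a
cuspidal decomposition group `C` in `Δⱼ`"; condition (3_Π): "a *nontrivial* image … of the decomposition
group in `Δ` of a cusp").

PROOF-ONLY file (no definition, no instance, no named `Prop` fact), abc-iut cell, seat abc-iut-w5-d033 (gen 16),
«L6 ROWS #6» slice (d2) input of abc-iut-L6-lead §F v1.19eh (A) (T1g11-F1 consumer repair, L4-lead m172 (4) /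
L6-lead INBOX 05:28:44Z), L4 vocabulary only.  It is abc-iut-L6-t2's `EllipticCuspidalizationChainNonDegeneracy.lean`
(p448798) VERBATIM on the print-faithful successor record `AbsTopII.EllipticCuspidalizationTF` (abc-iut-L4-t4, p496811)
and its chain-content predicate `EllipticCuspidalizationTF.RealizesChain` (`EllipticCuspidalizationTFContent.lean`):
the three proofs read only the fields `cuspU`/`projU`/`PiD`/`PiV`/`glue`/`glue_comm`/`toCore_isOpenInjective`, all
copied by the successor, and never the re-typed clause (ii) `torsionFree_PiD`.  Consumed BY NAME, nothing restated:
`ChainGroup.ne_bot_of_mem_cuspidalDecompGroups`, `PiChain.psi_eq_one_of_first_step`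
(`EllipticCuspidalizationCanonicalPinScope.lean`).

WHAT IS PROVED.  For `K : AbsTopII.EllipticCuspidalizationTF E` with `2 ≤ K.N` that REALIZES the printed chain
relative to ANY cuspidal data `CD` (`K.RealizesChain S CD hP hΔ hne`):
* `RealizesChain.exists_ne_one_projU_eq_one` — some `x ≠ 1` of `Π_U` dies under `Π_U ↠ Π_D`;
* `RealizesChain.projU_not_injective_of_two_le` — `Π_U ↠ Π_D` is NOT injective;
* `RealizesChain.proj_not_injective_of_two_le` — neither is THE OUTPUT `Π_{U_X} ↠ Π'`.
USE (L6, same row): the identity-TF record of abc-iut-L6-d7 (`identityRecordTF`, p501476: `proj = 𝟙`) realizes NO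
chain of level `N ≥ 2`; the v2-TF successor predicate `RefIsEllipticChainTF` of [IUTchII] Prop 1.6 (ii) keeps its
degenerate-inhabitant exclusion after the re-point (`RefIsEllipticChainTF.not_of_completesToIso`).
FQ-TYPE RULE (gate dedup): the record binder is written with its fully-qualified
type in each signature, since the short text coincides with p448798's.  HONEST FRAMING: an elementary statement about OUR typed output structure; nothing in print is contradicted or
endorsed; no side taken on [IUTchIII] Cor 3.12; typed ≠ proved; nothing here asserts abc proved or refuted.
-/

open Topology

universe u


namespace Literature.AnabelianGeometry.AbsoluteAnabelian.AbsTopII.EllipticCuspidalizationTF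

open Literature.AlgebraicGeometry.Frobenioids (IsSlimGroup)
open FundamentalExtension

variable {E : FundamentalExtension.{u}} {S : Set ℕ} {CD : CuspidalData E} {hP : IsSlimGroup E.arith} {hΔ : IsSlimGroup E.geom} {hne : E.geom ≠ ⊥}

/-- **Cor 3.3 (iii)(a) + [AbsTopI] Def 4.2 (iii)(c), (3_Π), over the print-faithful record**: if the TF record
realizes the printed chain and `N ≥ 2` (at least one de-cuspidalization step `U_1 ⇝ D`), then some nontrivial
element of `Π_U` is killed by `Π_U ↠ Π_D` — the (3_Π) cuspidal decomposition group of the first • step is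
nontrivial and lies in the kernel of the •-composite, which IS `projU` by the last clause of `RealizesChain`
(abc-iut-L6-t2's `EllipticCuspidalization.RealizesChain.exists_ne_one_projU_eq_one`, p448798, VERBATIM on the
successor record; no field (ii) is read). [cite: MochizukiAbsTopII2013, Cor 3.3 (iii)(a) p.68] -/
theorem RealizesChain.exists_ne_one_projU_eq_one
    {K : Literature.AnabelianGeometry.AbsoluteAnabelian.AbsTopII.EllipticCuspidalizationTF E}
    (h : EllipticCuspidalizationTF.RealizesChain K S CD hP hΔ hne) (h2 : 2 ≤ K.N) :
    ∃ x : K.cuspU.arith, x ≠ 1 ∧ K.projU.arith x = 1 := by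
  obtain ⟨c, -, -, -, s, t, v, hst, htv, hvl, eU, eD, eV, gU, gD, gV, ψ, -, -, -, hψs, hsteps, hlast⟩ := h
  -- `N ≥ 2` gives at least one • step: `s < t`
  have hN : 1 ≤ K.N ^ 2 - 1 := by
    have : 2 ^ 2 ≤ K.N ^ 2 := Nat.pow_le_pow_left h2 2
    omega
  have hlt : s.val < t.val := by omega
  have hslen : s.val < c.len := by omega
  -- the first • step `φs : Π_s ↠ Π_{s+1}` with its (3_Π) group `D ≠ ⊥`
  set js : Fin c.len := ⟨s.val, hslen⟩ with hjs
  obtain ⟨φs, hde, hψ1⟩ := hsteps js (le_refl _) hlt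
  obtain ⟨-, -, D, hDmem, hker, -⟩ := hde
  have hDne : D ≠ ⊥ := ChainGroup.ne_bot_of_mem_cuspidalDecompGroups hDmem
  obtain ⟨y, hyD, hy1⟩ : ∃ y ∈ D, y ≠ 1 := by
    by_contra hall
    push Not at hall
    exact hDne ((Subgroup.eq_bot_iff_forall _).mpr hall)
  have hDker : φs y = 1 := by
    have hy' : y ∈ φs.toMonoidHom.ker := by
      rw [hker]
      exact Subgroup.le_topologicalClosure _ (Subgroup.le_normalClosure hyD)
    exact hy'
  refine ⟨eU.symm y, fun h0 => hy1 ?_, ?_⟩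
  · -- `eU⁻¹ y = 1 ⇒ y = 1`
    have h0' := congrArg eU h0
    rwa [ContinuousMulEquiv.apply_symm_apply, map_one] at h0'
  · -- `φs (eU (eU⁻¹ y)) = φs y = 1 ⇒ ψ_{s+1} (eU⁻¹ y) = 1 ⇒ ψ_t (eU⁻¹ y) = 1 ⇒ projU (eU⁻¹ y) = 1`
    have hs1 : s.val + 1 < c.len + 1 := by omega
    have hφs : ∀ x, φs (eU x) = 1 → ψ js.succ x = 1 := by
      intro x hx
      have hcast : ψ js.castSucc x = eU x := hψs x
      rw [hψ1 x, hcast, hx]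
    have hzero : ψ t (eU.symm y) = 1 :=
      c.psi_eq_one_of_first_step s t eU ψ hsteps hs1 φs hφs (K.N ^ 2 - 1 - 1) t (by omega) le_rfl _
        (by rw [ContinuousMulEquiv.apply_symm_apply]; exact hDker)
    have hl := hlast (eU.symm y)
    rw [hzero, map_one] at hl
    rw [← hl]
    rfl

/-- **Non-degeneracy of the chain conjunct over the TF record, `Π_U ↠ Π_D`**: a print-faithful record realizing the
printed chain with `N ≥ 2` has NON-injective `projU`. [cite: MochizukiAbsTopII2013, Cor 3.3 (iii)(a) p.68] -/
theorem RealizesChain.projU_not_injective_of_two_le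
    {K : Literature.AnabelianGeometry.AbsoluteAnabelian.AbsTopII.EllipticCuspidalizationTF E}
    (h : EllipticCuspidalizationTF.RealizesChain K S CD hP hΔ hne) (h2 : 2 ≤ K.N) :
    ¬ Function.Injective K.projU.arith := by
  intro hinj
  obtain ⟨x, hx1, hx⟩ := h.exists_ne_one_projU_eq_one h2
  exact hx1 (hinj (by rw [hx, map_one]))

/-- **Non-degeneracy of the chain conjunct over the TF record, THE OUTPUT `Π_{U_X} ↠ Π'`**: a print-faithful record
realizing the printed chain with `N ≥ 2` has NON-injective `proj` — through the fibre product `glue` / `glue_comm`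
of Cor 3.3 (iii)(a)(b) and the open injection `Π' ↪ Π_C` (`toCore`), exactly as p448798 for the frozen record.  In
particular an ISOMORPHISM `Π_{U_X} ⥲ Π'` (e.g. the identity) realizes no chain of level `≥ 2`.
[cite: MochizukiAbsTopII2013, Cor 3.3 (iii)(a)(b) pp.68-69] -/
theorem RealizesChain.proj_not_injective_of_two_le
    {K : Literature.AnabelianGeometry.AbsoluteAnabelian.AbsTopII.EllipticCuspidalizationTF E}
    (h : EllipticCuspidalizationTF.RealizesChain K S CD hP hΔ hne) (h2 : 2 ≤ K.N) :
    ¬ Function.Injective K.proj.arith := by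
  intro hinj
  obtain ⟨x, hx1, hx⟩ := h.exists_ne_one_projU_eq_one h2
  -- `x` lies over `1 ∈ toCore(Π_V)`, hence in the target of `glue`
  have hxmem : x ∈ (K.PiV.map K.toCore.arith.toMonoidHom).comap K.projU.arith.toMonoidHom := by
    rw [Subgroup.mem_comap]
    change K.projU.arith x ∈ _
    rw [hx]
    exact Subgroup.one_mem _
  obtain ⟨z, hz⟩ : ∃ z, K.glue z = ⟨x, hxmem⟩ := K.glue.surjective ⟨x, hxmem⟩
  have hcomm := K.glue_comm z
  rw [hz] at hcomm
  change K.toCore.arith (K.proj.arith (z : K.cuspUX.arith)) = K.projU.arith x at hcomm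
  rw [hx] at hcomm
  -- `toCore` injective ⇒ `proj z = 1`; `proj` injective ⇒ `z = 1`
  have hpz : K.proj.arith (z : K.cuspUX.arith) = 1 :=
    K.toCore_isOpenInjective.arith_injective (by rw [hcomm, map_one])
  have hz1 : (z : K.cuspUX.arith) = 1 := hinj (by rw [hpz, map_one])
  have hz1' : z = 1 := Subtype.ext hz1
  apply hx1
  have hxz : x = ((K.glue z : ↥((K.PiV.map K.toCore.arith.toMonoidHom).comap K.projU.arith.toMonoidHom)) :
      K.cuspU.arith) := by
    rw [hz]
  rw [hxz, hz1', map_one]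
  rfl

end Literature.AnabelianGeometry.AbsoluteAnabelian.AbsTopII.EllipticCuspidalizationTF
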